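import Summits.AtomisticToContinuum.Crystallization.Theorems.PricedLinkCensusStackingHingeDilationPinningShell

/-!
# `StackingHinge` (stmt-AtomisticToContinuum-14993), line `Sketch` (skeleton v37), stub `stub_dilationPinning` (V6):
# helper file B — word-uniform GROSS bounds on the site energy of a Barlow stacking at extreme scales

The two extreme regimes of the scale comparison of V6, uniformly in the Hägg word (`h' ≥ 0.8161 b`, so
that distinct points are `≥ 0.999 b` apart, `dist_barlowPos_ge_of_ratio`):

* `siteEnergy_dilute` (`b ≥ 2`): `V_LJ ≥ −r⁻⁶/6` termwise and the shell sum
  `sum_inv_dist_pow_six_le_of_far` give `barlowSiteEnergy ≥ −(250/12)(0.999 b)⁻⁶ ≥ −7/20`;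
* `siteEnergy_compressed_nonneg` (`b ≤ 0.6127`): the six in-layer neighbours at distance `b` contribute
  `6 V_LJ(b) = u²/2 − u` (`u = b⁻⁶ ≥ 18.86`) to twice the site energy, the at most `126` points within
  `2b` cost at most `1/12` each (`V_LJ ≥ −1/12`, packing bound `card_le_of_separated_of_dist_le`), the
  points beyond `2b` at most `(23/6) u` (shell sum), and `u²/2 − (1 + 23/6) u − 126/12 ≥ 0`.

Both bounds are read through the `ℤ³` parametrisation of the punctured Lennard-Jones sum
(`tsum_barlowPos_eq_two_mul_barlowSiteEnergy_of_word`, minorants with bounded partial sums).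
All `[folklore]`.
-/

noncomputable section

namespace Summit.AtomisticToContinuum.Crystallization.Theorems.PricedHcpWindowsDilationPinning

open Literature.MathematicalPhysics.StatisticalMechanics
open Summit.AtomisticToContinuum.Crystallization.Theorems.SquareWellLayerCake.StackingFaultSparsity
  (summable_lennardJones_barlowPos_of_word tsum_barlowPos_eq_two_mul_barlowSiteEnergy_of_word)

/-! ## The dilute regime `b ≥ 2` -/

/-- **Dilute stackings.**  For `b ≥ 2`, `h' ≥ 0.8161 b` and a Hägg word `s`, the site energy of
`barlowStacking b h' s` is `≥ −7/20`: termwise `V_LJ ≥ −r⁻⁶/6`, every other point is `≥ 0.999 b` away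
from the site and from each other, and the shell sum gives `∑ |y|⁻⁶ ≤ 250 (0.999 b)⁻⁶ ≤ 250 (500/999)⁶`.
[folklore] -/
theorem siteEnergy_dilute {b h' : ℝ} (hb : 2 ≤ b) (hlo : 8161 / 10000 * b ≤ h') {s : ℤ → ℤ}
    (hs : IsHaggSeq s) : -(7 / 20) ≤ barlowSiteEnergy lennardJones b h' s 0 := by
  classical
  have hb0 : 0 < b := by linarith
  have hh'0 : 0 < h' := by nlinarith
  set P : ℤ × ℤ × ℤ → EuclideanSpace ℝ (Fin 3) := fun q => barlowPos b h' s q.1 q.2.1 q.2.2 with hP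
  have hinj : Function.Injective P := barlowPos_injective hb0 hh'0 s
  have hsep : ∀ q q', q ≠ q' → 999 / 1000 * b ≤ dist (P q) (P q') := fun q q' hne =>
    dist_barlowPos_ge_of_ratio hb0 hlo hs hne
  set r : ℝ := 999 / 1000 * b with hr
  have hr0 : 0 < r := by positivity
  have hF : Summable fun q : ℤ × ℤ × ℤ => lennardJones (dist (P 0) (P q)) :=
    summable_lennardJones_barlowPos_of_word hb0 hh'0 s 0 0 0
  have hFE : ∑' q : ℤ × ℤ × ℤ, lennardJones (dist (P 0) (P q)) =
      2 * barlowSiteEnergy lennardJones b h' s 0 :=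
    tsum_barlowPos_eq_two_mul_barlowSiteEnergy_of_word hb0 hh'0 s 0
  -- the inverse sixth powers have bounded partial sums
  set D : ℤ × ℤ × ℤ → ℝ := fun q => (dist (P 0) (P q))⁻¹ ^ 6 with hD
  have hD0 : ∀ q, 0 ≤ D q := fun q => by positivity
  have hDsum : ∀ T : Finset (ℤ × ℤ × ℤ), ∑ q ∈ T, D q ≤ 250 * r⁻¹ ^ 6 := by
    intro T
    have h0 : D 0 = 0 := by simp [hD]
    rw [← Finset.sum_erase T h0]
    have hsum : ∑ q ∈ T.erase 0, D q = ∑ y ∈ (T.erase 0).image P, (dist (P 0) y)⁻¹ ^ 6 := by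
      rw [Finset.sum_image (fun q _ q' _ h => hinj h)]
    rw [hsum]
    refine (sum_inv_dist_pow_six_le_of_far _ (P 0) hr0 hr0 ?_ ?_).trans ?_
    · intro y hy y' hy' hne
      obtain ⟨q, -, rfl⟩ := Finset.mem_image.1 hy
      obtain ⟨q', -, rfl⟩ := Finset.mem_image.1 hy'
      exact hsep q q' (fun h => hne (by rw [h]))
    · intro y hy
      obtain ⟨q, hq, rfl⟩ := Finset.mem_image.1 hy
      exact hsep 0 q (Ne.symm (Finset.ne_of_mem_erase hq))
    · have : 4 * r / r = 4 := by field_simp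
      rw [this]
      norm_num
  have hDs : Summable D := summable_of_sum_le hD0 hDsum
  have htD : ∑' q, D q ≤ 250 * r⁻¹ ^ 6 := hDs.tsum_le_of_sum_le hDsum
  -- comparison with `V_LJ ≥ −r⁻⁶/6` (the repulsion is non-negative; inlined, the landed copy of this
  -- one-liner lives in a module that is not importable next to this line's skeleton)
  have hV6 : ∀ ρ : ℝ, -(1 / 6) * ρ⁻¹ ^ 6 ≤ lennardJones ρ := fun ρ => by
    unfold lennardJones
    have : 0 ≤ ρ⁻¹ ^ 12 := by positivity
    linarith
  have hle : ∑' q, (-(1 / 6) * D q) ≤ ∑' q : ℤ × ℤ × ℤ, lennardJones (dist (P 0) (P q)) :=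
    Summable.tsum_le_tsum (fun q => hV6 _) (hDs.mul_left _) hF
  rw [tsum_mul_left, hFE] at hle
  -- numerics: `r ≥ 999/500`
  have hr2 : (999 / 500 : ℝ) ≤ r := by rw [hr]; linarith
  have hri : r⁻¹ ≤ 500 / 999 := by
    rw [inv_le_comm₀ hr0 (by norm_num)]
    rw [inv_div]
    exact hr2
  have hri6 : r⁻¹ ^ 6 ≤ (500 / 999 : ℝ) ^ 6 := pow_le_pow_left₀ (by positivity) hri 6
  have hnum : (250 : ℝ) * (500 / 999 : ℝ) ^ 6 ≤ 4 := by norm_num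
  nlinarith

/-! ## The compressed regime `b ≤ 0.6127` -/

/-- **Compressed stackings.**  For `0 < b ≤ 0.6127`, `h' ≥ 0.8161 b` and a Hägg word `s`, the site
energy of `barlowStacking b h' s` is `≥ 0`: the six in-layer neighbours at distance `b` contribute
`6 V_LJ(b) = u²/2 − u` (`u = b⁻⁶ ≥ 18.86`) to twice the site energy, the at most `126` points within
`2b` (packing) cost at most `1/12` each (`V_LJ ≥ −1/12`), and the points beyond `2b` at most
`(1/6) · 23 u` (shell sum, `V_LJ ≥ −r⁻⁶/6`). [folklore] -/
theorem siteEnergy_compressed_nonneg {b h' : ℝ} (hb0 : 0 < b) (hb : b ≤ 6127 / 10000)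
    (hlo : 8161 / 10000 * b ≤ h') {s : ℤ → ℤ} (hs : IsHaggSeq s) :
    0 ≤ barlowSiteEnergy lennardJones b h' s 0 := by
  classical
  have hh'0 : 0 < h' := by nlinarith
  have hbne : b ≠ 0 := hb0.ne'
  set P : ℤ × ℤ × ℤ → EuclideanSpace ℝ (Fin 3) := fun q => barlowPos b h' s q.1 q.2.1 q.2.2 with hP
  have hinj : Function.Injective P := barlowPos_injective hb0 hh'0 s
  have hsep : ∀ q q', q ≠ q' → 999 / 1000 * b ≤ dist (P q) (P q') := fun q q' hne =>
    dist_barlowPos_ge_of_ratio hb0 hlo hs hne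
  set r : ℝ := 999 / 1000 * b with hr
  have hr0 : 0 < r := by positivity
  have hF : Summable fun q : ℤ × ℤ × ℤ => lennardJones (dist (P 0) (P q)) :=
    summable_lennardJones_barlowPos_of_word hb0 hh'0 s 0 0 0
  have hFE : ∑' q : ℤ × ℤ × ℤ, lennardJones (dist (P 0) (P q)) =
      2 * barlowSiteEnergy lennardJones b h' s 0 :=
    tsum_barlowPos_eq_two_mul_barlowSiteEnergy_of_word hb0 hh'0 s 0
  -- the six in-layer neighbours
  set N6 : Finset (ℤ × ℤ × ℤ) :=
    {(0, 1, 0), (0, -1, 0), (0, 0, 1), (0, 0, -1), (0, 1, -1), (0, -1, 1)} with hN6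
  have hN6card : N6.card = 6 := by rw [hN6]; decide
  have hN6dist : ∀ q ∈ N6, dist (P 0) (P q) = b := by
    intro q hq
    have key : ∀ i j : ℤ, ((i : ℝ) ^ 2 + i * j + j ^ 2 = 1) → dist (P 0) (P (0, i, j)) = b := by
      intro i j hij
      have hsq : dist (P 0) (P (0, i, j)) ^ 2 = b ^ 2 := by
        show dist (barlowPos b h' s 0 0 0) (barlowPos b h' s 0 i j) ^ 2 = b ^ 2
        rw [dist_barlowPos_inLayer_sq, hij, mul_one]
      exact (pow_left_inj₀ dist_nonneg hb0.le two_ne_zero).1 hsq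
    simp only [hN6, Finset.mem_insert, Finset.mem_singleton] at hq
    rcases hq with rfl | rfl | rfl | rfl | rfl | rfl <;> exact key _ _ (by push_cast; norm_num)
  -- the minorant `G = G1 − G2/12 − G3/6`
  set G1 : ℤ × ℤ × ℤ → ℝ := fun q => if q ∈ N6 then lennardJones b else 0 with hG1
  set G2 : ℤ × ℤ × ℤ → ℝ := fun q =>
    if q ∉ N6 ∧ q ≠ 0 ∧ dist (P 0) (P q) < 2 * b then 1 else 0 with hG2
  set G3 : ℤ × ℤ × ℤ → ℝ := fun q =>
    if 2 * b ≤ dist (P 0) (P q) then (dist (P 0) (P q))⁻¹ ^ 6 else 0 with hG3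
  set G : ℤ × ℤ × ℤ → ℝ := fun q => G1 q - 1 / 12 * G2 q - 1 / 6 * G3 q with hG
  have hV6 : ∀ ρ : ℝ, -(1 / 6) * ρ⁻¹ ^ 6 ≤ lennardJones ρ := fun ρ => by
    unfold lennardJones
    have : 0 ≤ ρ⁻¹ ^ 12 := by positivity
    linarith
  have hFG : ∀ q, G q ≤ lennardJones (dist (P 0) (P q)) := by
    intro q
    simp only [hG, hG1, hG2, hG3]
    by_cases hq : q ∈ N6
    · have hd := hN6dist q hq
      have hnot : ¬ (2 * b ≤ dist (P 0) (P q)) := by rw [hd]; linarith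
      rw [if_pos hq, if_neg (fun h => h.1 hq), if_neg hnot, hd]
      linarith
    · rw [if_neg hq]
      by_cases hq0 : q = 0
      · subst hq0
        have hd0 : dist (P 0) (P 0) = 0 := dist_self _
        rw [if_neg (fun h => h.2.1 rfl), hd0, if_neg (by linarith), lennardJones_zero]
        linarith
      · by_cases hfar : 2 * b ≤ dist (P 0) (P q)
        · rw [if_neg (fun h => (not_lt.2 hfar) h.2.2), if_pos hfar]
          have := hV6 (dist (P 0) (P q))
          linarith
        · rw [if_pos ⟨hq, hq0, lt_of_not_ge hfar⟩, if_neg hfar]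
          have := neg_one_div_le_lennardJones (dist (P 0) (P q))
          linarith
  -- `G1`: finitely supported, sum `6 V_LJ(b)`
  have hG1zero : ∀ q ∉ N6, G1 q = 0 := fun q hq => by simp only [hG1, if_neg hq]
  have hG1s : Summable G1 := summable_of_ne_finset_zero hG1zero
  have hG1t : ∑' q, G1 q = 6 * lennardJones b := by
    rw [tsum_eq_sum hG1zero,
      Finset.sum_congr rfl (fun q hq => show G1 q = lennardJones b by simp only [hG1, if_pos hq]),
      Finset.sum_const, hN6card, nsmul_eq_mul]
    norm_num
  -- `G2`: the near points number at most `126`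
  have hG20 : ∀ q, 0 ≤ G2 q := fun q => by simp only [hG2]; split_ifs <;> norm_num
  have hG2sum : ∀ T : Finset (ℤ × ℤ × ℤ), ∑ q ∈ T, G2 q ≤ 126 := by
    intro T
    set Tn := T.filter fun q => q ∉ N6 ∧ q ≠ 0 ∧ dist (P 0) (P q) < 2 * b with hTn
    have h1 : ∑ q ∈ T, G2 q = (Tn.card : ℝ) := by
      simp only [hG2]
      rw [Finset.sum_boole]
    have h2 : (Tn.card : ℝ) = ((Tn.image P).card : ℝ) := by
      rw [Finset.card_image_of_injective _ hinj]
    have h3 : ((Tn.image P).card : ℝ) ≤ (2 * (2 * b) / r + 1) ^ 3 := by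
      have := card_le_of_separated_of_dist_le (Tn.image P) (P 0) hr0
        (by positivity : (0 : ℝ) ≤ 2 * b) ?_ ?_
      · rwa [finrank_euclideanSpace_fin] at this
      · intro c hc
        obtain ⟨q, hq, rfl⟩ := Finset.mem_image.1 hc
        rw [dist_comm]
        exact le_of_lt (Finset.mem_filter.1 hq).2.2.2
      · intro c hc c' hc' hne
        obtain ⟨q, -, rfl⟩ := Finset.mem_image.1 hc
        obtain ⟨q', -, rfl⟩ := Finset.mem_image.1 hc'
        exact hsep q q' (fun h => hne (by rw [h]))
    have h4 : (2 * (2 * b) / r + 1) ^ 3 ≤ 126 := by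
      have : 2 * (2 * b) / r = 4000 / 999 := by
        rw [hr]
        field_simp
        ring
      rw [this]
      norm_num
    linarith [h1, h2, h3, h4]
  have hG2s : Summable G2 := summable_of_sum_le hG20 hG2sum
  have hG2t : ∑' q, G2 q ≤ 126 := hG2s.tsum_le_of_sum_le hG2sum
  -- `G3`: the far points, shell sum
  have hG30 : ∀ q, 0 ≤ G3 q := fun q => by simp only [hG3]; split_ifs <;> positivity
  have hG3sum : ∀ T : Finset (ℤ × ℤ × ℤ), ∑ q ∈ T, G3 q ≤ 23 * b⁻¹ ^ 6 := by
    intro T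
    set Tf := T.filter fun q => 2 * b ≤ dist (P 0) (P q) with hTf
    have h1 : ∑ q ∈ T, G3 q = ∑ q ∈ Tf, (dist (P 0) (P q))⁻¹ ^ 6 := by
      simp only [hG3]
      rw [hTf, Finset.sum_filter]
    have h2 : ∑ q ∈ Tf, (dist (P 0) (P q))⁻¹ ^ 6 = ∑ y ∈ Tf.image P, (dist (P 0) y)⁻¹ ^ 6 := by
      rw [Finset.sum_image (fun q _ q' _ h => hinj h)]
    have h3 : ∑ y ∈ Tf.image P, (dist (P 0) y)⁻¹ ^ 6 ≤
        2 * (4 * (2 * b) / r + 1) ^ 3 * (2 * b)⁻¹ ^ 6 := by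
      refine sum_inv_dist_pow_six_le_of_far _ (P 0) hr0 (by positivity) ?_ ?_
      · intro y hy y' hy' hne
        obtain ⟨q, -, rfl⟩ := Finset.mem_image.1 hy
        obtain ⟨q', -, rfl⟩ := Finset.mem_image.1 hy'
        exact hsep q q' (fun h => hne (by rw [h]))
      · intro y hy
        obtain ⟨q, hq, rfl⟩ := Finset.mem_image.1 hy
        exact (Finset.mem_filter.1 hq).2
    have h4 : 2 * (4 * (2 * b) / r + 1) ^ 3 * (2 * b)⁻¹ ^ 6 ≤ 23 * b⁻¹ ^ 6 := by
      have e1 : 4 * (2 * b) / r = 8000 / 999 := by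
        rw [hr]
        field_simp
        ring
      have e2 : (2 * b)⁻¹ ^ 6 = 1 / 64 * b⁻¹ ^ 6 := by
        rw [mul_inv, mul_pow]
        norm_num
      rw [e1, e2]
      have hb6 : 0 ≤ b⁻¹ ^ 6 := by positivity
      nlinarith [hb6]
    linarith [h1, h2, h3, h4]
  have hG3s : Summable G3 := summable_of_sum_le hG30 hG3sum
  have hG3t : ∑' q, G3 q ≤ 23 * b⁻¹ ^ 6 := hG3s.tsum_le_of_sum_le hG3sum
  -- comparison of the sums
  have hG12s : Summable fun q => G1 q - 1 / 12 * G2 q := hG1s.sub (hG2s.mul_left (1 / 12))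
  have hGs : Summable G := hG12s.sub (hG3s.mul_left (1 / 6))
  have hGt : ∑' q, G q = 6 * lennardJones b - 1 / 12 * ∑' q, G2 q - 1 / 6 * ∑' q, G3 q := by
    rw [show G = fun q => (G1 q - 1 / 12 * G2 q) - 1 / 6 * G3 q from rfl,
      hG12s.tsum_sub (hG3s.mul_left (1 / 6)), hG1s.tsum_sub (hG2s.mul_left (1 / 12)),
      tsum_mul_left, tsum_mul_left, hG1t]
  have hle : ∑' q, G q ≤ ∑' q : ℤ × ℤ × ℤ, lennardJones (dist (P 0) (P q)) :=
    Summable.tsum_le_tsum hFG hGs hF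
  rw [hGt, hFE] at hle
  -- numerics: `u = b⁻⁶ ≥ 18.86`
  have hu : (18 : ℝ) + 86 / 100 ≤ b⁻¹ ^ 6 := by
    have h1 : (10000 / 6127 : ℝ) ≤ b⁻¹ := by
      rw [le_inv_comm₀ (by norm_num) hb0]
      norm_num
      exact hb
    have h2 : (10000 / 6127 : ℝ) ^ 6 ≤ b⁻¹ ^ 6 := pow_le_pow_left₀ (by norm_num) h1 6
    have h3 : (18 : ℝ) + 86 / 100 ≤ (10000 / 6127 : ℝ) ^ 6 := by norm_num
    linarith
  have hLJ : lennardJones b = 1 / 12 * (b⁻¹ ^ 6) ^ 2 - 1 / 6 * b⁻¹ ^ 6 := by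
    unfold lennardJones
    ring
  rw [hLJ] at hle
  nlinarith [hle, hG2t, hG3t, hu,
    mul_nonneg (sub_nonneg.2 hu) (by positivity : (0 : ℝ) ≤ b⁻¹ ^ 6 / 2 + 9 / 2)]

end Summit.AtomisticToContinuum.Crystallization.Theorems.PricedHcpWindowsDilationPinning

end
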